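import Summits.BirchSwinnertonDyer.BirchSwinnertonDyer.Theses.KatoDescentPotSupersingular
import Summits.BirchSwinnertonDyer.BirchSwinnertonDyer.Theorems.KatoDescentPotSupersingularWildJetchevBoundAtPTwoSplit
import HarnessLib

/-!
# BC3 birth skeleton — item stmt-BirchSwinnertonDyer-21422 `WildJetchevBoundAtPTwoSplit`
# (route `KatoDescentPotSupersingular`, rung K9; split child gen 1 of crux 19941 `WildJetchevBoundAtP`, case «2 splits in K»)

REGISTERED by the tenure planner (plan g24, 2026-08-27). ADOPTED verbatim from seat `bsd-potss-k9-c4` g11's kernel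
reduction (`Theorems/KatoDescentPotSupersingularWildJetchevBoundAtPTwoSplit.lean`, p564034, ns
`…Theorems.JetchevIrreducibleSwapAtP`): the child is a THEOREM modulo FOUR NAMED LITERATURE FACTS (cite-level, no
`_holds` in the tree) and the route's held conjunction `PublishedInputsHeegner` (item 19914). Hence EVERY stub below is a
CITE STUB (a published input stated BY NAME) — there is NO reading-level prover target left on this child; it closes when
the four facts are proved in `Literature/` (each XL) or re-typed as held alias items by an operator re-key (plan g24 (36c)).

Stubs (5, all cite-level):
* `stub_MN19thm07` — Matar–Nekovář 2019 Thm 0.7 / §0.11 (Kolyvagin's structure theorem on irreducible image; = S1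
  `Sig.stub_structureIrred` of the 20165 / 19941 skeletons, verbatim constant);
* `stub_gross37_2` — Gross 1991 (LMS 153) Prop 3.7 (2), Eichler–Shimura congruence for Heegner points (typed with the
  guard `ℓ ≠ 2 ∨ ρ̄_p onto`; at a 2-split K the Kolyvagin prime 2 never occurs, p560752);
* `stub_poitouTateSelmer` — Poitou–Tate duality for Selmer structures (Milne ADT I.4.10), every number field K;
* `stub_GZ86III31imageFree` — Gross–Zagier 1986 III (3.1) / Gross 1991: Heegner points minus rational torsion lie in
  E⁰, image-free form;
* `stub_publishedInputsHeegner` — the route's held conjunction (GZ86, Kolyvagin 1990, MN19 Thm 0.3, newforms, BFH 1990).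

`WildJetchevBoundAtPTwoSplit_of` composes them through k9-c4 g11's
`JetchevIrreducibleSwapAtP.wildJetchevBoundAtPTwoSplit_of_namedFacts` and concludes the item decl BY NAME.
Sorries: exactly the five `stub_*`; nothing else. Nothing is booked; BSD is proved for no curve by this file.
-/

set_option autoImplicit false
set_option linter.dupNamespace false

noncomputable section

open scoped Classical

namespace Summit.BirchSwinnertonDyer.BirchSwinnertonDyer.Cruxes.WildJetchevBoundAtPTwoSplit.Birth

open Literature.NumberTheory.EllipticCurves Literature.NumberTheory.GaloisCohomology
open Summit.BirchSwinnertonDyer.BirchSwinnertonDyer.Theses.KatoDescentPotSupersingular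

/-- cite stub S1: Matar–Nekovář 2019 Thm 0.7 (structure theorem, irreducible image) BY NAME. -/
theorem stub_MN19thm07 :
    MatarNekovar2019.thm07_padicValNat_card_sha_primary_add_le_of_globalDivisibility_of_irreducible := by
  sorry

/-- cite stub: Gross 1991 Prop 3.7 (2) (Frobenius / Eichler–Shimura congruence) BY NAME. -/
theorem stub_gross37_2 : GrossLMS1991.prop37_2_frobeniusCongruence := by
  sorry

/-- cite stub: Poitou–Tate duality for Selmer structures at every number field BY NAME. -/
theorem stub_poitouTateSelmer :
    ∀ (K : Type) [Field K] [NumberField K], poitouTate_selmerStructure_duality_conj K := by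
  sorry

/-- cite stub: GZ86 III (3.1) / Gross 1991 — Heegner point minus rational torsion in E⁰, image-free, BY NAME. -/
theorem stub_GZ86III31imageFree : Gross1991_heegnerPoint_sub_ratTorsion_mem_E0_imageFree := by
  sorry

/-- cite stub: the route's held conjunction `PublishedInputsHeegner` (item 19914). -/
theorem stub_publishedInputsHeegner : PublishedInputsHeegner := by
  sorry

/-- COMPOSITION (kernel-checked, no sorry of its own): the five cite stubs give the child item BY NAME through
k9-c4 g11's `wildJetchevBoundAtPTwoSplit_of_namedFacts`. -/
theorem WildJetchevBoundAtPTwoSplit_of :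
    MatarNekovar2019.thm07_padicValNat_card_sha_primary_add_le_of_globalDivisibility_of_irreducible →
    GrossLMS1991.prop37_2_frobeniusCongruence →
    (∀ (K : Type) [Field K] [NumberField K], poitouTate_selmerStructure_duality_conj K) →
    Gross1991_heegnerPoint_sub_ratTorsion_mem_E0_imageFree →
    PublishedInputsHeegner →
    Summit.BirchSwinnertonDyer.BirchSwinnertonDyer.Theses.KatoDescentPotSupersingular.WildJetchevBoundAtPTwoSplit := by
  intro hS1 h37 hPT hF1 hH
  exact Summit.BirchSwinnertonDyer.BirchSwinnertonDyer.Theorems.JetchevIrreducibleSwapAtP.wildJetchevBoundAtPTwoSplit_of_namedFacts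
    hS1 h37 hPT hF1 hH

/-- the child, from the stubs (sanity instance of the composition). -/
theorem WildJetchevBoundAtPTwoSplit_of_stubs :
    Summit.BirchSwinnertonDyer.BirchSwinnertonDyer.Theses.KatoDescentPotSupersingular.WildJetchevBoundAtPTwoSplit :=
  WildJetchevBoundAtPTwoSplit_of stub_MN19thm07 stub_gross37_2 stub_poitouTateSelmer stub_GZ86III31imageFree
    stub_publishedInputsHeegner

end Summit.BirchSwinnertonDyer.BirchSwinnertonDyer.Cruxes.WildJetchevBoundAtPTwoSplit.Birth

end
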